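import Summits.QuantumFields.BalabanUV.Beta.GAN24.T2UnitSplitShapes

/-!
# `BalabanUV.Beta.GAN24.T2UnitSplitFrom` — binder row G-an2-4 / (CONV-C), W-slot, road «W3» (F1): THE LEVEL SUMS OF THE NORMALISED T₂ TOWER
# AND OF ITS DIFFERENCE TOWER FROM AN ARBITRARY START LEVEL `s` (the (F1) ingredient of the «unroll from D₁» repair (R1) of ROW W3-F4d)
# (G-an2-4 FORMAL swarm, leaf-01 lineage, gen 15; «W3-F1-FROM*»)

NOT IN PRINT; OUR BOOKKEEPING.  HONEST FRAMING (cell contract, verbatim): «discharging `BetaPertH` makes Bałaban's UV stability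
UNCONDITIONAL — a real constructive-QFT result; it is NOT the continuum limit and NOT the Clay problem.»  HONEST DEPENDENCY (verbatim):
«continuum YM on T⁴ ⇐ BetaPertH ∧ nine spine estimates (0/9 proved); BetaPertH ⇐ (D1) ∧ (D4) ∧ CAP+tail; G-an2-4 gates asym, D1 and
NE2/3/4.»

WHY.  The row owner's END #2 `WSlotT2OfPieces.rate_of_rows` (p213240) is stated for an ARBITRARY difference tower `D` unrolled from its member
`D 0` (`hsplit`) with `hZ0 : Zfree (D 0)`; leaf-18-g17's located ⊥-candidate (journal l.9613, kernel half `ChargeStepSym` p213920) shows that at the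
§8.3 instantiation `D 0 := T♮₁ − T♮₀` the binder `hZ0` is unreachable for a bond-asymmetric initial quartic charge, and recommends the repair
(R1) «unroll from `D₁`» — the bond-antisymmetric defect dies after one transport.  (R1) is END-free: apply `rate_of_rows` to the SHIFTED tower
`D′ n := D (n+1)`; its `hsplit` is then the (F1b) level sum FROM LEVEL 1.  This module supplies the (F1) level sums from ANY start level `s`
(pure algebra, derived from the landed engine `AffineUnroll` and the landed (F1) modules — nothing re-proved, nothing landed restated):
* §1 (generic additive group, any affine recursion on a class) `eq_transport_add_sum_from`, `diff_eq_transport_add_sum_from` —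
  `AffineUnroll.eq_transport_add_sum` / `diff_eq_transport_add_sum` applied to the recursion re-indexed from level `s`, `transport_shift`;
* §2 (an2's normalised tower, GENERIC off-diagonal border `Bd`, modulo `hB` and `hmix` only) `succ_eq_lin4_add_of_shapes` (the affine step with
  the per-level step data discharged by `T2UnitSplitShapes.step_data_of_shapes`), `lin4_bdd₄`, `lin4_add_bdd₄`, `bracket_bdd₄_of_shapes` (the class data), **`unitS₂_T2Of_eq_transport_add_sum_from_of_shapes`** (levels from `s`),
  **`unitS₂_T2Of_sub_eq_transport_add_sum_from_of_shapes`** (differences from `s`);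
* §3 (an1's base-root border `vh₂S d Lc` = the ENDs' literal tables, modulo `hmix` only) `…_from_vh₂S_of_mix` ×2 and the `s = 1` text
  **`unitS₂_T2Of_sub_eq_transport_add_sum_one_vh₂S_of_mix`** in the consumer's numerals:
  `D♮_{n+1} = transport 𝒜 2 n D♮_1 + Σ_{m<n} transport 𝒜 (m+3) (n−1−m) f♮_{m+1}` — the `hsplit` of `rate_of_rows` at `D := fun n ↦ D♮ (n+1)`,
  `P := fun m k ↦ transport 𝒜 (m+2) k`, `f := fun m ↦ f♮ (m+1)`.
At `s = 0` §2/§3 are the landed texts of `T2UnitSplitShapes` / `T2UnitSplitBorder` (not restated here).  Whether (R1) or another repair is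
adopted is the row OWNER's ruling; this module only makes (R1) cost no (F1) work.
[folklore] kernel algebra + composition of tree theorems; every constant per level EXISTENTIAL; asserts NO j-uniform bound, NO zero mode,
NO sum rule; (F1) is bookkeeping and discharges NO estimate; instantiates NO wall binder; «T2Shape»/«T2SupRate»/«T2Drift» OPEN, NOT IN PRINT;
discharges NOTHING of (hW, hWall); NOT «W-slot closed», NEVER «G-an2-4 closed»; NOT BetaPertH, NOT continuum, NOT Clay.
-/

noncomputable section

open Finset
open scoped BigOperators
open Literature.MathematicalPhysics.QuantumFieldTheory
open Literature.MathematicalPhysics.QuantumFieldTheory.Balaban1983to89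
open Literature.MathematicalPhysics.QuantumFieldTheory.Balaban1983to89.Beta
open ExpKernelCalculus (MKer Decays VertexFamily₂)
open OneStepResolventKernel (Fib)
open OneStepKernelFamily (KInvStep decays_KInvStep)
open StepJetData (mfNeg)
open SecondOrderResponse (W2SymOfK LocStencilFM)
open BalabanCompositeJets (LocStencil₂)
open BalabanStepJetsSucc (mmRead)
open BalabanStepW2 (K3OfK Spure M1 M2Of T2Of)
open AveragingMixedJetTables (vh₂S)
open Summit.QuantumFields.BalabanUV.Beta.HessKerDressedUnits (unitK unitS decays_unitK)
open Summit.QuantumFields.BalabanUV.Beta.SecondOrderUnits (unitM unitS₂ unitM₂)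
open Summit.QuantumFields.BalabanUV.Beta.GAN24.CombesThomas (sfStep smStep)
open Summit.QuantumFields.BalabanUV.Beta.GAN24.T2SlotUnits (vh₂S_inl_inl vh₂S_inr_inr locStencil₂_vh₂S)
open Summit.QuantumFields.BalabanUV.Beta.GAN24.T2RecursionAffine (lin4)
open Summit.QuantumFields.BalabanUV.Beta.GAN24.AffineUnroll (transport transport_shift mem_of_rec eq_transport_add_sum
  diff_eq_transport_add_sum)
open Summit.QuantumFields.BalabanUV.Beta.GAN24.Lin4Additive (lin4_bdd)
open Summit.QuantumFields.BalabanUV.Beta.GAN24.T2UnitSplitLevels (bdd₄_zero bdd₄_add bdd₄_sub lin4_add_of_bdd₄ unitS₂_T2Of_succ_eq_lin4_add)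
open Summit.QuantumFields.BalabanUV.Beta.GAN24.T2UnitSplitShapes (step_data_of_shapes bdd₄_unitS₂_T2Of_of_shapes)

namespace Summit.QuantumFields.BalabanUV.Beta.GAN24.T2UnitSplitFrom

/-! ## §1 Generic: the level sums of an affine recursion from an arbitrary start level -/

section Generic

variable {E : Type*} [AddCommGroup E] {A : ℕ → E → E} {P : E → Prop}

/-- [folklore] **THE LEVEL SUM FROM LEVEL `s` (discrete Duhamel).**  For `x (j+1) = A j (x j) + b j` on a class `P ∋ 0` closed under `+`,
preserved by the additive-on-`P` maps `A j`, with `x 0 ∈ P` and every `b j ∈ P`: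
`x (n + s) = transport A s n (x s) + Σ_{m<n} transport A (m+1+s) (n−1−m) (b (m+s))` — `AffineUnroll.eq_transport_add_sum` for the recursion
re-indexed from level `s`, composites re-based by `transport_shift`.  (`s = 0` is the landed text.) -/
theorem eq_transport_add_sum_from (hP0 : P 0) (hPadd : ∀ x y, P x → P y → P (x + y)) (hAP : ∀ j x, P x → P (A j x))
    (hAadd : ∀ j x y, P x → P y → A j (x + y) = A j x + A j y) {x b : ℕ → E} (hx0 : P (x 0)) (hb : ∀ j, P (b j))
    (hrec : ∀ j, x (j + 1) = A j (x j) + b j) (s n : ℕ) :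
    x (n + s) = transport A s n (x s) + ∑ m ∈ Finset.range n, transport A (m + 1 + s) (n - 1 - m) (b (m + s)) := by
  have hxs : P ((fun j => x (j + s)) 0) := by
    show P (x (0 + s)); rw [Nat.zero_add]; exact mem_of_rec hPadd hAP hx0 hb hrec s
  have h := eq_transport_add_sum (A := fun j => A (j + s)) (P := P) (x := fun j => x (j + s)) (b := fun j => b (j + s))
    hP0 hPadd (fun j y hy => hAP (j + s) y hy) (fun j y z hy hz => hAadd (j + s) y z hy hz) hxs (fun j => hb (j + s))
    (fun j => by
      show x (j + 1 + s) = A (j + s) (x (j + s)) + b (j + s)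
      rw [Nat.add_right_comm]; exact hrec (j + s)) n
  simpa only [transport_shift, Nat.zero_add] using h

/-- [folklore] **THE DIFFERENCE TOWER UNROLLED FROM LEVEL `s`.**  With the forcing `f j := (A (j+1) (x j) − A j (x j)) + (b (j+1) − b j)` of
`AffineUnroll.diff_succ`: `x (n+1+s) − x (n+s) = transport A (1+s) n (x (1+s) − x s) + Σ_{m<n} transport A (m+2+s) (n−1−m) (f (m+s))` —
`AffineUnroll.diff_eq_transport_add_sum` for the recursion re-indexed from level `s`.  (`s = 0` is the landed text; `s = 1` is the `hsplit` of
the «unroll from `D₁`» repair (R1).) -/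
theorem diff_eq_transport_add_sum_from (hP0 : P 0) (hPadd : ∀ x y, P x → P y → P (x + y)) (hPsub : ∀ x y, P x → P y → P (x - y))
    (hAP : ∀ j x, P x → P (A j x)) (hAadd : ∀ j x y, P x → P y → A j (x + y) = A j x + A j y) {x b : ℕ → E}
    (hx0 : P (x 0)) (hb : ∀ j, P (b j)) (hrec : ∀ j, x (j + 1) = A j (x j) + b j) (s n : ℕ) :
    x (n + 1 + s) - x (n + s) = transport A (1 + s) n (x (1 + s) - x s) +
      ∑ m ∈ Finset.range n, transport A (m + 2 + s) (n - 1 - m)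
        ((A (m + 1 + s) (x (m + s)) - A (m + s) (x (m + s))) + (b (m + 1 + s) - b (m + s))) := by
  have hxs : P ((fun j => x (j + s)) 0) := by
    show P (x (0 + s)); rw [Nat.zero_add]; exact mem_of_rec hPadd hAP hx0 hb hrec s
  have h := diff_eq_transport_add_sum (A := fun j => A (j + s)) (P := P) (x := fun j => x (j + s)) (b := fun j => b (j + s))
    hP0 hPadd hPsub (fun j y hy => hAP (j + s) y hy) (fun j y z hy hz => hAadd (j + s) y z hy hz) hxs (fun j => hb (j + s))
    (fun j => by
      show x (j + 1 + s) = A (j + s) (x (j + s)) + b (j + s)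
      rw [Nat.add_right_comm]; exact hrec (j + s)) n
  simpa only [transport_shift, Nat.zero_add, Nat.add_right_comm _ 1 s, Nat.add_right_comm _ 2 s] using h

end Generic

variable {d : ℕ}

/-! ## §2 an2's normalised tower, generic off-diagonal border: the class data and the level sums from level `s` -/

section Shapes

variable {Lc : ℕ} [NeZero Lc] (cE cVH cΛ cE₂ cB : ℝ) (Tc : Fin 4 → Fin 4 → Fin 4 → Fin 4 → ℝ)
  (mixFF : Fin (d + 1) → (Fin (d + 1) → ℤ) → Fin (d + 1) → (Fin (d + 1) → ℤ) → MKer (d + 1) (Fib d))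

/-- [folklore] **THE AFFINE STEP MODULO THE SHAPES** (generic off-diagonal border `Bd`): `T♮_{j+1} = 𝒜_j T♮_j + b♮_j` — leaf-04's step in
`Pi` form (`T2UnitSplitLevels.unitS₂_T2Of_succ_eq_lin4_add`) with the per-level step data discharged by `T2UnitSplitShapes.step_data_of_shapes`. -/
theorem succ_eq_lin4_add_of_shapes (hLc : 1 ≤ Lc)
    (Bd : Fin (d + 1) → (Fin (d + 1) → ℤ) → Fin (d + 1) → (Fin (d + 1) → ℤ) → MKer (d + 1) (Fib d))
    (hBff : ∀ κ u κ' u' x z (α β : Fin (d + 1)), Bd κ u κ' u' x z (Sum.inl α) (Sum.inl β) = 0)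
    (hBmm : ∀ κ u κ' u' x z (μ ν : Fin (d + 1)), Bd κ u κ' u' x z (Sum.inr μ) (Sum.inr ν) = 0)
    (hB : ∃ C δ : ℝ, 0 < δ ∧ LocStencil₂ Bd C δ) (hmix : ∃ C δ : ℝ, 0 < δ ∧ LocStencilFM Lc mixFF C δ) (j : ℕ) :
    unitS₂ (sfStep Lc (j + 1)) (smStep d Lc (j + 1)) (T2Of d Lc cE cVH cΛ cE₂ cB Tc Bd mixFF (j + 1)) =
      lin4 (cE₂ * (Lc : ℝ) ^ (2 * (d + 1))) (unitK (sfStep Lc j) (smStep d Lc j) (KInvStep (d := d) Lc j)) Lc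
          (unitS₂ (sfStep Lc j) (smStep d Lc j) (T2Of d Lc cE cVH cΛ cE₂ cB Tc Bd mixFF j)) +
        (fun κ u κ' u' => (cE₂ * (Lc : ℝ) ^ (2 * (d + 1))) • mmRead Lc (K3OfK (unitK (sfStep Lc j) (smStep d Lc j) (KInvStep (d := d) Lc j)) Lc
                (unitS (sfStep Lc j) (smStep d Lc j) (Spure d Lc cE cVH cΛ j)) (unitM (sfStep Lc j) (smStep d Lc j) (M1 d Lc cΛ j))
                (W2SymOfK (unitK (sfStep Lc j) (smStep d Lc j) (KInvStep (d := d) Lc j)) Lc (unitS (sfStep Lc j) (smStep d Lc j) (Spure d Lc cE cVH cΛ j))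
                (unitM (sfStep Lc j) (smStep d Lc j) (M1 d Lc cΛ j)) 0 (unitM₂ (sfStep Lc j) (smStep d Lc j) (M2Of d Lc mixFF j))) κ u κ' u') +
                cB • mfNeg (Bd κ u κ' u')) := by
  obtain ⟨C, δ, C₀, C₁, hδ, hK, h₀, hW⟩ := step_data_of_shapes hLc cE cVH cΛ cE₂ cB Tc hB hmix j
  exact unitS₂_T2Of_succ_eq_lin4_add cE cVH cΛ cE₂ cB Tc Bd mixFF hBff hBmm j hδ hK h₀ hW

/-- [folklore] Every `𝒜_j = lin4 c₄ K♮_j Lc` maps bounded bi-tables to bounded bi-tables (`Lin4Additive.lin4_bdd`; the kernel decay is an4's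
`decays_KInvStep` in units, `HessKerDressedUnits.decays_unitK` — no shape hypothesis). -/
theorem lin4_bdd₄ (j : ℕ) (X : Fin (d + 1) → (Fin (d + 1) → ℤ) → Fin (d + 1) → (Fin (d + 1) → ℤ) → MKer (d + 1) (Fib d))
    (hX : ∃ B : ℝ, ∀ κ u κ' u' x z a b, |X κ u κ' u' x z a b| ≤ B) :
    ∃ B : ℝ, ∀ κ u κ' u' x z a b, |lin4 (cE₂ * (Lc : ℝ) ^ (2 * (d + 1))) (unitK (sfStep Lc j) (smStep d Lc j) (KInvStep (d := d) Lc j)) Lc X κ u κ' u' x z a b| ≤ B := by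
  obtain ⟨δK, CK, hδK, -, hK⟩ := decays_KInvStep (Lc := Lc) (d := d) j
  exact lin4_bdd (decays_unitK (sf := sfStep Lc j) (sm := smStep d Lc j) hK) hδK _ Lc hX

/-- [folklore] Every `𝒜_j` is additive on bounded bi-tables (`T2UnitSplitLevels.lin4_add_of_bdd₄`; no shape hypothesis). -/
theorem lin4_add_bdd₄ (j : ℕ) (X Y : Fin (d + 1) → (Fin (d + 1) → ℤ) → Fin (d + 1) → (Fin (d + 1) → ℤ) → MKer (d + 1) (Fib d))
    (hX : ∃ B : ℝ, ∀ κ u κ' u' x z a b, |X κ u κ' u' x z a b| ≤ B) (hY : ∃ B : ℝ, ∀ κ u κ' u' x z a b, |Y κ u κ' u' x z a b| ≤ B) :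
    lin4 (cE₂ * (Lc : ℝ) ^ (2 * (d + 1))) (unitK (sfStep Lc j) (smStep d Lc j) (KInvStep (d := d) Lc j)) Lc (X + Y) =
      lin4 (cE₂ * (Lc : ℝ) ^ (2 * (d + 1))) (unitK (sfStep Lc j) (smStep d Lc j) (KInvStep (d := d) Lc j)) Lc X +
        lin4 (cE₂ * (Lc : ℝ) ^ (2 * (d + 1))) (unitK (sfStep Lc j) (smStep d Lc j) (KInvStep (d := d) Lc j)) Lc Y := by
  obtain ⟨δK, CK, hδK, -, hK⟩ := decays_KInvStep (Lc := Lc) (d := d) j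
  exact lin4_add_of_bdd₄ (decays_unitK (sf := sfStep Lc j) (sm := smStep d Lc j) hK) hδK _ Lc hX hY

/-- [folklore] Every source `b♮_j` (leaf-04's bracket at border `Bd`) has bounded entries: `b♮_j = T♮_{j+1} − 𝒜_j T♮_j`
(`T2UnitSplitLevels.bdd₄_sub`, `T2UnitSplitShapes.bdd₄_unitS₂_T2Of_of_shapes`). -/
theorem bracket_bdd₄_of_shapes (hLc : 1 ≤ Lc)
    (Bd : Fin (d + 1) → (Fin (d + 1) → ℤ) → Fin (d + 1) → (Fin (d + 1) → ℤ) → MKer (d + 1) (Fib d))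
    (hBff : ∀ κ u κ' u' x z (α β : Fin (d + 1)), Bd κ u κ' u' x z (Sum.inl α) (Sum.inl β) = 0)
    (hBmm : ∀ κ u κ' u' x z (μ ν : Fin (d + 1)), Bd κ u κ' u' x z (Sum.inr μ) (Sum.inr ν) = 0)
    (hB : ∃ C δ : ℝ, 0 < δ ∧ LocStencil₂ Bd C δ) (hmix : ∃ C δ : ℝ, 0 < δ ∧ LocStencilFM Lc mixFF C δ) (j : ℕ) :
    ∃ B : ℝ, ∀ κ u κ' u' x z a b, |(fun κ u κ' u' => (cE₂ * (Lc : ℝ) ^ (2 * (d + 1))) • mmRead Lc (K3OfK (unitK (sfStep Lc j) (smStep d Lc j) (KInvStep (d := d) Lc j)) Lc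
                (unitS (sfStep Lc j) (smStep d Lc j) (Spure d Lc cE cVH cΛ j)) (unitM (sfStep Lc j) (smStep d Lc j) (M1 d Lc cΛ j))
                (W2SymOfK (unitK (sfStep Lc j) (smStep d Lc j) (KInvStep (d := d) Lc j)) Lc (unitS (sfStep Lc j) (smStep d Lc j) (Spure d Lc cE cVH cΛ j))
                (unitM (sfStep Lc j) (smStep d Lc j) (M1 d Lc cΛ j)) 0 (unitM₂ (sfStep Lc j) (smStep d Lc j) (M2Of d Lc mixFF j))) κ u κ' u') +
                cB • mfNeg (Bd κ u κ' u')) κ u κ' u' x z a b| ≤ B := by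
  have e : (fun κ u κ' u' => (cE₂ * (Lc : ℝ) ^ (2 * (d + 1))) • mmRead Lc (K3OfK (unitK (sfStep Lc j) (smStep d Lc j) (KInvStep (d := d) Lc j)) Lc
                (unitS (sfStep Lc j) (smStep d Lc j) (Spure d Lc cE cVH cΛ j)) (unitM (sfStep Lc j) (smStep d Lc j) (M1 d Lc cΛ j))
                (W2SymOfK (unitK (sfStep Lc j) (smStep d Lc j) (KInvStep (d := d) Lc j)) Lc (unitS (sfStep Lc j) (smStep d Lc j) (Spure d Lc cE cVH cΛ j))
                (unitM (sfStep Lc j) (smStep d Lc j) (M1 d Lc cΛ j)) 0 (unitM₂ (sfStep Lc j) (smStep d Lc j) (M2Of d Lc mixFF j))) κ u κ' u') +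
                cB • mfNeg (Bd κ u κ' u')) =
      unitS₂ (sfStep Lc (j + 1)) (smStep d Lc (j + 1)) (T2Of d Lc cE cVH cΛ cE₂ cB (0 : Fin 4 → Fin 4 → Fin 4 → Fin 4 → ℝ) Bd mixFF (j + 1)) -
        lin4 (cE₂ * (Lc : ℝ) ^ (2 * (d + 1))) (unitK (sfStep Lc j) (smStep d Lc j) (KInvStep (d := d) Lc j)) Lc
          (unitS₂ (sfStep Lc j) (smStep d Lc j) (T2Of d Lc cE cVH cΛ cE₂ cB (0 : Fin 4 → Fin 4 → Fin 4 → Fin 4 → ℝ) Bd mixFF j)) := by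
    rw [succ_eq_lin4_add_of_shapes cE cVH cΛ cE₂ cB 0 mixFF hLc Bd hBff hBmm hB hmix j, add_sub_cancel_left]
  rw [e]
  exact bdd₄_sub (bdd₄_unitS₂_T2Of_of_shapes hLc cE cVH cΛ cE₂ cB 0 hB hmix (j + 1))
    (lin4_bdd₄ cE₂ j _ (bdd₄_unitS₂_T2Of_of_shapes hLc cE cVH cΛ cE₂ cB 0 hB hmix j))

/-- [folklore] **(F1a) FROM LEVEL `s`, MODULO `hB` AND `hmix` ONLY** (generic off-diagonal border): for all `s n`,
`T♮_{n+s} = transport 𝒜 s n T♮_s + Σ_{m<n} transport 𝒜 (m+1+s) (n−1−m) b♮_{m+s}` (§1 `eq_transport_add_sum_from` on the class of bounded bi-tables). -/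
theorem unitS₂_T2Of_eq_transport_add_sum_from_of_shapes (hLc : 1 ≤ Lc)
    (Bd : Fin (d + 1) → (Fin (d + 1) → ℤ) → Fin (d + 1) → (Fin (d + 1) → ℤ) → MKer (d + 1) (Fib d))
    (hBff : ∀ κ u κ' u' x z (α β : Fin (d + 1)), Bd κ u κ' u' x z (Sum.inl α) (Sum.inl β) = 0)
    (hBmm : ∀ κ u κ' u' x z (μ ν : Fin (d + 1)), Bd κ u κ' u' x z (Sum.inr μ) (Sum.inr ν) = 0)
    (hB : ∃ C δ : ℝ, 0 < δ ∧ LocStencil₂ Bd C δ) (hmix : ∃ C δ : ℝ, 0 < δ ∧ LocStencilFM Lc mixFF C δ) (s n : ℕ) :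
    unitS₂ (sfStep Lc (n + s)) (smStep d Lc (n + s)) (T2Of d Lc cE cVH cΛ cE₂ cB Tc Bd mixFF (n + s)) =
      transport (fun j => lin4 (cE₂ * (Lc : ℝ) ^ (2 * (d + 1))) (unitK (sfStep Lc j) (smStep d Lc j) (KInvStep (d := d) Lc j)) Lc) s n
            (unitS₂ (sfStep Lc s) (smStep d Lc s) (T2Of d Lc cE cVH cΛ cE₂ cB Tc Bd mixFF s)) +
        ∑ m ∈ Finset.range n, transport (fun j => lin4 (cE₂ * (Lc : ℝ) ^ (2 * (d + 1))) (unitK (sfStep Lc j) (smStep d Lc j) (KInvStep (d := d) Lc j)) Lc) (m + 1 + s) (n - 1 - m)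
              (fun κ u κ' u' => (cE₂ * (Lc : ℝ) ^ (2 * (d + 1))) • mmRead Lc (K3OfK (unitK (sfStep Lc (m + s)) (smStep d Lc (m + s)) (KInvStep (d := d) Lc (m + s))) Lc
                (unitS (sfStep Lc (m + s)) (smStep d Lc (m + s)) (Spure d Lc cE cVH cΛ (m + s))) (unitM (sfStep Lc (m + s)) (smStep d Lc (m + s)) (M1 d Lc cΛ (m + s)))
                (W2SymOfK (unitK (sfStep Lc (m + s)) (smStep d Lc (m + s)) (KInvStep (d := d) Lc (m + s))) Lc (unitS (sfStep Lc (m + s)) (smStep d Lc (m + s)) (Spure d Lc cE cVH cΛ (m + s)))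
                (unitM (sfStep Lc (m + s)) (smStep d Lc (m + s)) (M1 d Lc cΛ (m + s))) 0 (unitM₂ (sfStep Lc (m + s)) (smStep d Lc (m + s)) (M2Of d Lc mixFF (m + s)))) κ u κ' u') +
                cB • mfNeg (Bd κ u κ' u')) :=
  eq_transport_add_sum_from (A := (fun j => lin4 (cE₂ * (Lc : ℝ) ^ (2 * (d + 1))) (unitK (sfStep Lc j) (smStep d Lc j) (KInvStep (d := d) Lc j)) Lc))
    (P := fun X => ∃ B : ℝ, ∀ κ u κ' u' x z a b, |X κ u κ' u' x z a b| ≤ B)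
    (x := fun j => unitS₂ (sfStep Lc j) (smStep d Lc j) (T2Of d Lc cE cVH cΛ cE₂ cB Tc Bd mixFF j))
    (b := fun j => (fun κ u κ' u' => (cE₂ * (Lc : ℝ) ^ (2 * (d + 1))) • mmRead Lc (K3OfK (unitK (sfStep Lc j) (smStep d Lc j) (KInvStep (d := d) Lc j)) Lc
                (unitS (sfStep Lc j) (smStep d Lc j) (Spure d Lc cE cVH cΛ j)) (unitM (sfStep Lc j) (smStep d Lc j) (M1 d Lc cΛ j))
                (W2SymOfK (unitK (sfStep Lc j) (smStep d Lc j) (KInvStep (d := d) Lc j)) Lc (unitS (sfStep Lc j) (smStep d Lc j) (Spure d Lc cE cVH cΛ j))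
                (unitM (sfStep Lc j) (smStep d Lc j) (M1 d Lc cΛ j)) 0 (unitM₂ (sfStep Lc j) (smStep d Lc j) (M2Of d Lc mixFF j))) κ u κ' u') +
                cB • mfNeg (Bd κ u κ' u')))
    bdd₄_zero (fun _ _ => bdd₄_add) (lin4_bdd₄ cE₂) (lin4_add_bdd₄ cE₂)
    (bdd₄_unitS₂_T2Of_of_shapes hLc cE cVH cΛ cE₂ cB Tc hB hmix 0) (bracket_bdd₄_of_shapes cE cVH cΛ cE₂ cB mixFF hLc Bd hBff hBmm hB hmix)
    (succ_eq_lin4_add_of_shapes cE cVH cΛ cE₂ cB Tc mixFF hLc Bd hBff hBmm hB hmix) s n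

/-- [folklore] **(F1b) FROM LEVEL `s`, MODULO `hB` AND `hmix` ONLY** (generic off-diagonal border): for all `s n`, with `D♮_j := T♮_{j+1} − T♮_j`
and the forcing `f♮_j := (𝒜_{j+1} − 𝒜_j) T♮_j + (b♮_{j+1} − b♮_j)` of the landed (F1b),
`D♮_{n+s} = transport 𝒜 (1+s) n D♮_s + Σ_{m<n} transport 𝒜 (m+2+s) (n−1−m) f♮_{m+s}` (§1 `diff_eq_transport_add_sum_from`). -/
theorem unitS₂_T2Of_sub_eq_transport_add_sum_from_of_shapes (hLc : 1 ≤ Lc)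
    (Bd : Fin (d + 1) → (Fin (d + 1) → ℤ) → Fin (d + 1) → (Fin (d + 1) → ℤ) → MKer (d + 1) (Fib d))
    (hBff : ∀ κ u κ' u' x z (α β : Fin (d + 1)), Bd κ u κ' u' x z (Sum.inl α) (Sum.inl β) = 0)
    (hBmm : ∀ κ u κ' u' x z (μ ν : Fin (d + 1)), Bd κ u κ' u' x z (Sum.inr μ) (Sum.inr ν) = 0)
    (hB : ∃ C δ : ℝ, 0 < δ ∧ LocStencil₂ Bd C δ) (hmix : ∃ C δ : ℝ, 0 < δ ∧ LocStencilFM Lc mixFF C δ) (s n : ℕ) :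
    (fun κ u κ' u' => unitS₂ (sfStep Lc (n + 1 + s)) (smStep d Lc (n + 1 + s)) (T2Of d Lc cE cVH cΛ cE₂ cB Tc Bd mixFF (n + 1 + s)) κ u κ' u' -
        unitS₂ (sfStep Lc (n + s)) (smStep d Lc (n + s)) (T2Of d Lc cE cVH cΛ cE₂ cB Tc Bd mixFF (n + s)) κ u κ' u') =
      transport (fun j => lin4 (cE₂ * (Lc : ℝ) ^ (2 * (d + 1))) (unitK (sfStep Lc j) (smStep d Lc j) (KInvStep (d := d) Lc j)) Lc) (1 + s) n
            (fun κ u κ' u' =>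
          unitS₂ (sfStep Lc (1 + s)) (smStep d Lc (1 + s)) (T2Of d Lc cE cVH cΛ cE₂ cB Tc Bd mixFF (1 + s)) κ u κ' u' -
            unitS₂ (sfStep Lc s) (smStep d Lc s) (T2Of d Lc cE cVH cΛ cE₂ cB Tc Bd mixFF s) κ u κ' u') +
        ∑ m ∈ Finset.range n, transport (fun j => lin4 (cE₂ * (Lc : ℝ) ^ (2 * (d + 1))) (unitK (sfStep Lc j) (smStep d Lc j) (KInvStep (d := d) Lc j)) Lc) (m + 2 + s) (n - 1 - m)
          ((lin4 (cE₂ * (Lc : ℝ) ^ (2 * (d + 1))) (unitK (sfStep Lc (m + 1 + s)) (smStep d Lc (m + 1 + s)) (KInvStep (d := d) Lc (m + 1 + s))) Lc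
                (unitS₂ (sfStep Lc (m + s)) (smStep d Lc (m + s)) (T2Of d Lc cE cVH cΛ cE₂ cB Tc Bd mixFF (m + s))) -
              lin4 (cE₂ * (Lc : ℝ) ^ (2 * (d + 1))) (unitK (sfStep Lc (m + s)) (smStep d Lc (m + s)) (KInvStep (d := d) Lc (m + s))) Lc
                    (unitS₂ (sfStep Lc (m + s)) (smStep d Lc (m + s)) (T2Of d Lc cE cVH cΛ cE₂ cB Tc Bd mixFF (m + s)))) +
            ((fun κ u κ' u' => (cE₂ * (Lc : ℝ) ^ (2 * (d + 1))) • mmRead Lc (K3OfK (unitK (sfStep Lc (m + 1 + s)) (smStep d Lc (m + 1 + s)) (KInvStep (d := d) Lc (m + 1 + s))) Lc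
                (unitS (sfStep Lc (m + 1 + s)) (smStep d Lc (m + 1 + s)) (Spure d Lc cE cVH cΛ (m + 1 + s))) (unitM (sfStep Lc (m + 1 + s)) (smStep d Lc (m + 1 + s)) (M1 d Lc cΛ (m + 1 + s)))
                (W2SymOfK (unitK (sfStep Lc (m + 1 + s)) (smStep d Lc (m + 1 + s)) (KInvStep (d := d) Lc (m + 1 + s))) Lc (unitS (sfStep Lc (m + 1 + s)) (smStep d Lc (m + 1 + s)) (Spure d Lc cE cVH cΛ (m + 1 + s)))
                (unitM (sfStep Lc (m + 1 + s)) (smStep d Lc (m + 1 + s)) (M1 d Lc cΛ (m + 1 + s))) 0 (unitM₂ (sfStep Lc (m + 1 + s)) (smStep d Lc (m + 1 + s)) (M2Of d Lc mixFF (m + 1 + s)))) κ u κ' u') +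
                cB • mfNeg (Bd κ u κ' u')) -
                  (fun κ u κ' u' => (cE₂ * (Lc : ℝ) ^ (2 * (d + 1))) • mmRead Lc (K3OfK (unitK (sfStep Lc (m + s)) (smStep d Lc (m + s)) (KInvStep (d := d) Lc (m + s))) Lc
                (unitS (sfStep Lc (m + s)) (smStep d Lc (m + s)) (Spure d Lc cE cVH cΛ (m + s))) (unitM (sfStep Lc (m + s)) (smStep d Lc (m + s)) (M1 d Lc cΛ (m + s)))
                (W2SymOfK (unitK (sfStep Lc (m + s)) (smStep d Lc (m + s)) (KInvStep (d := d) Lc (m + s))) Lc (unitS (sfStep Lc (m + s)) (smStep d Lc (m + s)) (Spure d Lc cE cVH cΛ (m + s)))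
                (unitM (sfStep Lc (m + s)) (smStep d Lc (m + s)) (M1 d Lc cΛ (m + s))) 0 (unitM₂ (sfStep Lc (m + s)) (smStep d Lc (m + s)) (M2Of d Lc mixFF (m + s)))) κ u κ' u') +
                cB • mfNeg (Bd κ u κ' u')))) := by
  have h := diff_eq_transport_add_sum_from (A := (fun j => lin4 (cE₂ * (Lc : ℝ) ^ (2 * (d + 1))) (unitK (sfStep Lc j) (smStep d Lc j) (KInvStep (d := d) Lc j)) Lc))
    (P := fun X => ∃ B : ℝ, ∀ κ u κ' u' x z a b, |X κ u κ' u' x z a b| ≤ B)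
    (x := fun j => unitS₂ (sfStep Lc j) (smStep d Lc j) (T2Of d Lc cE cVH cΛ cE₂ cB Tc Bd mixFF j))
    (b := fun j => (fun κ u κ' u' => (cE₂ * (Lc : ℝ) ^ (2 * (d + 1))) • mmRead Lc (K3OfK (unitK (sfStep Lc j) (smStep d Lc j) (KInvStep (d := d) Lc j)) Lc
                (unitS (sfStep Lc j) (smStep d Lc j) (Spure d Lc cE cVH cΛ j)) (unitM (sfStep Lc j) (smStep d Lc j) (M1 d Lc cΛ j))
                (W2SymOfK (unitK (sfStep Lc j) (smStep d Lc j) (KInvStep (d := d) Lc j)) Lc (unitS (sfStep Lc j) (smStep d Lc j) (Spure d Lc cE cVH cΛ j))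
                (unitM (sfStep Lc j) (smStep d Lc j) (M1 d Lc cΛ j)) 0 (unitM₂ (sfStep Lc j) (smStep d Lc j) (M2Of d Lc mixFF j))) κ u κ' u') +
                cB • mfNeg (Bd κ u κ' u')))
    bdd₄_zero (fun _ _ => bdd₄_add) (fun _ _ => bdd₄_sub) (lin4_bdd₄ cE₂) (lin4_add_bdd₄ cE₂)
    (bdd₄_unitS₂_T2Of_of_shapes hLc cE cVH cΛ cE₂ cB Tc hB hmix 0) (bracket_bdd₄_of_shapes cE cVH cΛ cE₂ cB mixFF hLc Bd hBff hBmm hB hmix)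
    (succ_eq_lin4_add_of_shapes cE cVH cΛ cE₂ cB Tc mixFF hLc Bd hBff hBmm hB hmix) s n
  have e1 : (fun κ u κ' u' => unitS₂ (sfStep Lc (n + 1 + s)) (smStep d Lc (n + 1 + s)) (T2Of d Lc cE cVH cΛ cE₂ cB Tc Bd mixFF (n + 1 + s)) κ u κ' u' -
        unitS₂ (sfStep Lc (n + s)) (smStep d Lc (n + s)) (T2Of d Lc cE cVH cΛ cE₂ cB Tc Bd mixFF (n + s)) κ u κ' u') =
      unitS₂ (sfStep Lc (n + 1 + s)) (smStep d Lc (n + 1 + s)) (T2Of d Lc cE cVH cΛ cE₂ cB Tc Bd mixFF (n + 1 + s)) -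
        unitS₂ (sfStep Lc (n + s)) (smStep d Lc (n + s)) (T2Of d Lc cE cVH cΛ cE₂ cB Tc Bd mixFF (n + s)) := rfl
  have e0 : (fun κ u κ' u' => unitS₂ (sfStep Lc (1 + s)) (smStep d Lc (1 + s)) (T2Of d Lc cE cVH cΛ cE₂ cB Tc Bd mixFF (1 + s)) κ u κ' u' -
        unitS₂ (sfStep Lc s) (smStep d Lc s) (T2Of d Lc cE cVH cΛ cE₂ cB Tc Bd mixFF s) κ u κ' u') =
      unitS₂ (sfStep Lc (1 + s)) (smStep d Lc (1 + s)) (T2Of d Lc cE cVH cΛ cE₂ cB Tc Bd mixFF (1 + s)) -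
        unitS₂ (sfStep Lc s) (smStep d Lc s) (T2Of d Lc cE cVH cΛ cE₂ cB Tc Bd mixFF s) := rfl
  rw [e1, e0]
  exact h

end Shapes

/-! ## §3 an1's base-root border `vh₂S d Lc` (the ENDs' literal tables), modulo `hmix` only; the `s = 1` text of (R1) -/

section BaseRoot

variable {Lc : ℕ} [NeZero Lc] (cE cVH cΛ cE₂ cB : ℝ) (Tc : Fin 4 → Fin 4 → Fin 4 → Fin 4 → ℝ)
  (mixFF : Fin (d + 1) → (Fin (d + 1) → ℤ) → Fin (d + 1) → (Fin (d + 1) → ℤ) → MKer (d + 1) (Fib d))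

/-- [folklore] **(F1a) FROM LEVEL `s` FOR an1's BORDER TABLE, MODULO `hmix` ONLY** (border shape by leaf-19's `T2SlotUnits.locStencil₂_vh₂S`). -/
theorem unitS₂_T2Of_eq_transport_add_sum_from_vh₂S_of_mix (hLc : 1 ≤ Lc) (hmix : ∃ C δ : ℝ, 0 < δ ∧ LocStencilFM Lc mixFF C δ) (s n : ℕ) :
    unitS₂ (sfStep Lc (n + s)) (smStep d Lc (n + s)) (T2Of d Lc cE cVH cΛ cE₂ cB Tc (vh₂S d Lc) mixFF (n + s)) =
      transport (fun j => lin4 (cE₂ * (Lc : ℝ) ^ (2 * (d + 1))) (unitK (sfStep Lc j) (smStep d Lc j) (KInvStep (d := d) Lc j)) Lc) s n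
            (unitS₂ (sfStep Lc s) (smStep d Lc s) (T2Of d Lc cE cVH cΛ cE₂ cB Tc (vh₂S d Lc) mixFF s)) +
        ∑ m ∈ Finset.range n, transport (fun j => lin4 (cE₂ * (Lc : ℝ) ^ (2 * (d + 1))) (unitK (sfStep Lc j) (smStep d Lc j) (KInvStep (d := d) Lc j)) Lc) (m + 1 + s) (n - 1 - m)
              (fun κ u κ' u' => (cE₂ * (Lc : ℝ) ^ (2 * (d + 1))) • mmRead Lc (K3OfK (unitK (sfStep Lc (m + s)) (smStep d Lc (m + s)) (KInvStep (d := d) Lc (m + s))) Lc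
                (unitS (sfStep Lc (m + s)) (smStep d Lc (m + s)) (Spure d Lc cE cVH cΛ (m + s))) (unitM (sfStep Lc (m + s)) (smStep d Lc (m + s)) (M1 d Lc cΛ (m + s)))
                (W2SymOfK (unitK (sfStep Lc (m + s)) (smStep d Lc (m + s)) (KInvStep (d := d) Lc (m + s))) Lc (unitS (sfStep Lc (m + s)) (smStep d Lc (m + s)) (Spure d Lc cE cVH cΛ (m + s)))
                (unitM (sfStep Lc (m + s)) (smStep d Lc (m + s)) (M1 d Lc cΛ (m + s))) 0 (unitM₂ (sfStep Lc (m + s)) (smStep d Lc (m + s)) (M2Of d Lc mixFF (m + s)))) κ u κ' u') +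
                cB • mfNeg ((vh₂S d Lc) κ u κ' u')) :=
  unitS₂_T2Of_eq_transport_add_sum_from_of_shapes cE cVH cΛ cE₂ cB Tc mixFF hLc (vh₂S d Lc) (vh₂S_inl_inl Lc) (vh₂S_inr_inr Lc)
    ⟨_, 1, one_pos, locStencil₂_vh₂S hLc zero_le_one⟩ hmix s n

/-- [folklore] **(F1b) FROM LEVEL `s` FOR an1's BORDER TABLE, MODULO `hmix` ONLY.** -/
theorem unitS₂_T2Of_sub_eq_transport_add_sum_from_vh₂S_of_mix (hLc : 1 ≤ Lc) (hmix : ∃ C δ : ℝ, 0 < δ ∧ LocStencilFM Lc mixFF C δ) (s n : ℕ) :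
    (fun κ u κ' u' => unitS₂ (sfStep Lc (n + 1 + s)) (smStep d Lc (n + 1 + s)) (T2Of d Lc cE cVH cΛ cE₂ cB Tc (vh₂S d Lc) mixFF (n + 1 + s)) κ u κ' u' -
        unitS₂ (sfStep Lc (n + s)) (smStep d Lc (n + s)) (T2Of d Lc cE cVH cΛ cE₂ cB Tc (vh₂S d Lc) mixFF (n + s)) κ u κ' u') =
      transport (fun j => lin4 (cE₂ * (Lc : ℝ) ^ (2 * (d + 1))) (unitK (sfStep Lc j) (smStep d Lc j) (KInvStep (d := d) Lc j)) Lc) (1 + s) n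
            (fun κ u κ' u' =>
          unitS₂ (sfStep Lc (1 + s)) (smStep d Lc (1 + s)) (T2Of d Lc cE cVH cΛ cE₂ cB Tc (vh₂S d Lc) mixFF (1 + s)) κ u κ' u' -
            unitS₂ (sfStep Lc s) (smStep d Lc s) (T2Of d Lc cE cVH cΛ cE₂ cB Tc (vh₂S d Lc) mixFF s) κ u κ' u') +
        ∑ m ∈ Finset.range n, transport (fun j => lin4 (cE₂ * (Lc : ℝ) ^ (2 * (d + 1))) (unitK (sfStep Lc j) (smStep d Lc j) (KInvStep (d := d) Lc j)) Lc) (m + 2 + s) (n - 1 - m)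
          ((lin4 (cE₂ * (Lc : ℝ) ^ (2 * (d + 1))) (unitK (sfStep Lc (m + 1 + s)) (smStep d Lc (m + 1 + s)) (KInvStep (d := d) Lc (m + 1 + s))) Lc
                (unitS₂ (sfStep Lc (m + s)) (smStep d Lc (m + s)) (T2Of d Lc cE cVH cΛ cE₂ cB Tc (vh₂S d Lc) mixFF (m + s))) -
              lin4 (cE₂ * (Lc : ℝ) ^ (2 * (d + 1))) (unitK (sfStep Lc (m + s)) (smStep d Lc (m + s)) (KInvStep (d := d) Lc (m + s))) Lc
                    (unitS₂ (sfStep Lc (m + s)) (smStep d Lc (m + s)) (T2Of d Lc cE cVH cΛ cE₂ cB Tc (vh₂S d Lc) mixFF (m + s)))) +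
            ((fun κ u κ' u' => (cE₂ * (Lc : ℝ) ^ (2 * (d + 1))) • mmRead Lc (K3OfK (unitK (sfStep Lc (m + 1 + s)) (smStep d Lc (m + 1 + s)) (KInvStep (d := d) Lc (m + 1 + s))) Lc
                (unitS (sfStep Lc (m + 1 + s)) (smStep d Lc (m + 1 + s)) (Spure d Lc cE cVH cΛ (m + 1 + s))) (unitM (sfStep Lc (m + 1 + s)) (smStep d Lc (m + 1 + s)) (M1 d Lc cΛ (m + 1 + s)))
                (W2SymOfK (unitK (sfStep Lc (m + 1 + s)) (smStep d Lc (m + 1 + s)) (KInvStep (d := d) Lc (m + 1 + s))) Lc (unitS (sfStep Lc (m + 1 + s)) (smStep d Lc (m + 1 + s)) (Spure d Lc cE cVH cΛ (m + 1 + s)))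
                (unitM (sfStep Lc (m + 1 + s)) (smStep d Lc (m + 1 + s)) (M1 d Lc cΛ (m + 1 + s))) 0 (unitM₂ (sfStep Lc (m + 1 + s)) (smStep d Lc (m + 1 + s)) (M2Of d Lc mixFF (m + 1 + s)))) κ u κ' u') +
                cB • mfNeg ((vh₂S d Lc) κ u κ' u')) -
                  (fun κ u κ' u' => (cE₂ * (Lc : ℝ) ^ (2 * (d + 1))) • mmRead Lc (K3OfK (unitK (sfStep Lc (m + s)) (smStep d Lc (m + s)) (KInvStep (d := d) Lc (m + s))) Lc
                (unitS (sfStep Lc (m + s)) (smStep d Lc (m + s)) (Spure d Lc cE cVH cΛ (m + s))) (unitM (sfStep Lc (m + s)) (smStep d Lc (m + s)) (M1 d Lc cΛ (m + s)))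
                (W2SymOfK (unitK (sfStep Lc (m + s)) (smStep d Lc (m + s)) (KInvStep (d := d) Lc (m + s))) Lc (unitS (sfStep Lc (m + s)) (smStep d Lc (m + s)) (Spure d Lc cE cVH cΛ (m + s)))
                (unitM (sfStep Lc (m + s)) (smStep d Lc (m + s)) (M1 d Lc cΛ (m + s))) 0 (unitM₂ (sfStep Lc (m + s)) (smStep d Lc (m + s)) (M2Of d Lc mixFF (m + s)))) κ u κ' u') +
                cB • mfNeg ((vh₂S d Lc) κ u κ' u')))) :=
  unitS₂_T2Of_sub_eq_transport_add_sum_from_of_shapes cE cVH cΛ cE₂ cB Tc mixFF hLc (vh₂S d Lc) (vh₂S_inl_inl Lc) (vh₂S_inr_inr Lc)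
    ⟨_, 1, one_pos, locStencil₂_vh₂S hLc zero_le_one⟩ hmix s n

/-- [folklore] **(F1b) FROM LEVEL 1 — THE `hsplit` OF THE «UNROLL FROM D₁» REPAIR (R1), in the consumer's numerals**: for all `n`,
`D♮_{n+1} = transport 𝒜 2 n D♮_1 + Σ_{m<n} transport 𝒜 (m+3) (n−1−m) f♮_{m+1}`, i.e. the `hsplit` binder of `WSlotT2OfPieces.rate_of_rows` (p213240) at
`D := fun n ↦ D♮ (n+1)`, `P := fun m k ↦ transport 𝒜 (m+2) k`, `f := fun m ↦ f♮ (m+1)` (an1's `vh₂S d Lc`, modulo `hmix` only).  The previous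
theorem at `s := 1`; stated separately so that the END's binder is met by `exact`. -/
theorem unitS₂_T2Of_sub_eq_transport_add_sum_one_vh₂S_of_mix (hLc : 1 ≤ Lc) (hmix : ∃ C δ : ℝ, 0 < δ ∧ LocStencilFM Lc mixFF C δ) (n : ℕ) :
    (fun κ u κ' u' => unitS₂ (sfStep Lc (n + 2)) (smStep d Lc (n + 2)) (T2Of d Lc cE cVH cΛ cE₂ cB Tc (vh₂S d Lc) mixFF (n + 2)) κ u κ' u' -
        unitS₂ (sfStep Lc (n + 1)) (smStep d Lc (n + 1)) (T2Of d Lc cE cVH cΛ cE₂ cB Tc (vh₂S d Lc) mixFF (n + 1)) κ u κ' u') =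
      transport (fun j => lin4 (cE₂ * (Lc : ℝ) ^ (2 * (d + 1))) (unitK (sfStep Lc j) (smStep d Lc j) (KInvStep (d := d) Lc j)) Lc) 2 n
            (fun κ u κ' u' =>
          unitS₂ (sfStep Lc 2) (smStep d Lc 2) (T2Of d Lc cE cVH cΛ cE₂ cB Tc (vh₂S d Lc) mixFF 2) κ u κ' u' -
            unitS₂ (sfStep Lc 1) (smStep d Lc 1) (T2Of d Lc cE cVH cΛ cE₂ cB Tc (vh₂S d Lc) mixFF 1) κ u κ' u') +
        ∑ m ∈ Finset.range n, transport (fun j => lin4 (cE₂ * (Lc : ℝ) ^ (2 * (d + 1))) (unitK (sfStep Lc j) (smStep d Lc j) (KInvStep (d := d) Lc j)) Lc) (m + 3) (n - 1 - m)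
          ((lin4 (cE₂ * (Lc : ℝ) ^ (2 * (d + 1))) (unitK (sfStep Lc (m + 2)) (smStep d Lc (m + 2)) (KInvStep (d := d) Lc (m + 2))) Lc
                (unitS₂ (sfStep Lc (m + 1)) (smStep d Lc (m + 1)) (T2Of d Lc cE cVH cΛ cE₂ cB Tc (vh₂S d Lc) mixFF (m + 1))) -
              lin4 (cE₂ * (Lc : ℝ) ^ (2 * (d + 1))) (unitK (sfStep Lc (m + 1)) (smStep d Lc (m + 1)) (KInvStep (d := d) Lc (m + 1))) Lc
                    (unitS₂ (sfStep Lc (m + 1)) (smStep d Lc (m + 1)) (T2Of d Lc cE cVH cΛ cE₂ cB Tc (vh₂S d Lc) mixFF (m + 1)))) +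
            ((fun κ u κ' u' => (cE₂ * (Lc : ℝ) ^ (2 * (d + 1))) • mmRead Lc (K3OfK (unitK (sfStep Lc (m + 2)) (smStep d Lc (m + 2)) (KInvStep (d := d) Lc (m + 2))) Lc
                (unitS (sfStep Lc (m + 2)) (smStep d Lc (m + 2)) (Spure d Lc cE cVH cΛ (m + 2))) (unitM (sfStep Lc (m + 2)) (smStep d Lc (m + 2)) (M1 d Lc cΛ (m + 2)))
                (W2SymOfK (unitK (sfStep Lc (m + 2)) (smStep d Lc (m + 2)) (KInvStep (d := d) Lc (m + 2))) Lc (unitS (sfStep Lc (m + 2)) (smStep d Lc (m + 2)) (Spure d Lc cE cVH cΛ (m + 2)))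
                (unitM (sfStep Lc (m + 2)) (smStep d Lc (m + 2)) (M1 d Lc cΛ (m + 2))) 0 (unitM₂ (sfStep Lc (m + 2)) (smStep d Lc (m + 2)) (M2Of d Lc mixFF (m + 2)))) κ u κ' u') +
                cB • mfNeg ((vh₂S d Lc) κ u κ' u')) -
                  (fun κ u κ' u' => (cE₂ * (Lc : ℝ) ^ (2 * (d + 1))) • mmRead Lc (K3OfK (unitK (sfStep Lc (m + 1)) (smStep d Lc (m + 1)) (KInvStep (d := d) Lc (m + 1))) Lc
                (unitS (sfStep Lc (m + 1)) (smStep d Lc (m + 1)) (Spure d Lc cE cVH cΛ (m + 1))) (unitM (sfStep Lc (m + 1)) (smStep d Lc (m + 1)) (M1 d Lc cΛ (m + 1)))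
                (W2SymOfK (unitK (sfStep Lc (m + 1)) (smStep d Lc (m + 1)) (KInvStep (d := d) Lc (m + 1))) Lc (unitS (sfStep Lc (m + 1)) (smStep d Lc (m + 1)) (Spure d Lc cE cVH cΛ (m + 1)))
                (unitM (sfStep Lc (m + 1)) (smStep d Lc (m + 1)) (M1 d Lc cΛ (m + 1))) 0 (unitM₂ (sfStep Lc (m + 1)) (smStep d Lc (m + 1)) (M2Of d Lc mixFF (m + 1)))) κ u κ' u') +
                cB • mfNeg ((vh₂S d Lc) κ u κ' u')))) :=
  unitS₂_T2Of_sub_eq_transport_add_sum_from_vh₂S_of_mix cE cVH cΛ cE₂ cB Tc mixFF hLc hmix 1 n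

end BaseRoot

end Summit.QuantumFields.BalabanUV.Beta.GAN24.T2UnitSplitFrom

end
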